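import Summits.CriticalPhenomena.PercolationContinuityZ3.Theorems.PercNearOneGluingNoHeavyQuantSGCLightPairPieces
import HarnessLib

/-!
# QUANT lane R8, T-DEC, leg (III): the POOLED MANY-COPY partial flow — gated products with a NO-LOW second factor

builds on p205010 (kernel theorem, internal audit signed; external expert review pending)

Support file (`--supports stmt-CriticalPhenomena-4575`), QUANT lane seat prim-quant-arm-2 (gen 37), rung R8 of
`run/shared/lean/prim/quant/LADDER.md`.  One theorem, standard axioms, no sorries.  Generalises `lightPair_partial` (`…QuantSGCLightPairPartial`,
two copies) to any finite family of copies: the gated product `L = gate_q(μ₁ ∗ ν₂)` with a second factor `ν₂ = Σ_s w_s δ_s` on `{0..M₂}` all of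
whose charged atoms are NOT LOW for the increment (`w_s > 0 ⟹ Δ ≤ 2s`, "no-low"; light admissible pairs and 73 % of the residue triples are
no-low).  At the product layer `j` the copies `s ≤ j` with `w_s > 0` are PRESENT (source flows `f s` of `ν₁ = gate_q μ₁` at layer `j − s`), the
others sit on giants.  THE PARTIAL FLOW: the shifted mid pairs of every present copy (`lightPair_copy`) plus the POOLED giant-bound masses shipped
proportionally into the POOLED slots (`usage_slot_le_shift`: every nonzero atom of `L` is `≥` some present shift `≥ Δ/2`).  CONCLUSIONS: the five
bookkeeping conjuncts of `gatedShift_partial` and the DICHOTOMY — either the unplaced mass plus the present copies' share `(1−q)·Σ_{present} w_s`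
of the gate zero is at most what their certified giant rooms absorb, or every nonzero low is fully placed.

[this work]; the one-copy construction: typer g26 (this lane).  The gluing rows served [cite: KozmaNitzan2024, Conjecture 3 (p. 15)]; product measure
[cite: Grimmett1999, §1.3 p. 10].
-/

noncomputable section

namespace Summit.CriticalPhenomena.PercolationContinuityZ3.Theorems

namespace Quant

open Finset

namespace LawDec

/-- **THE POOLED MANY-COPY PARTIAL FLOW** (file header).  `0 < y < 1`, `0 < q`, `0 < S`; weights `w ≥ 0` on the shifts with the NO-LOW
property `w s > 0 ⟹ Δ ≤ 2s`, `0 < Δ`; `M₁ + M₂ ≤ M`, `j < M`; `L t = Σ_{s ≤ M₂} w_s·[s ≤ t]·q μ₁(t−s)` for `t ≥ 1`; source flows `f s` of `gate_q μ₁`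
at layer `j − s` for every present copy (`1 ≤ s ≤ j`, `s ≤ M₂`, `w s > 0`). [this work] -/
theorem noLow_partial (y S Δ q : ℝ) (j M₁ M₂ M : ℕ) (μ₁ L w : ℕ → ℝ) (f : ℕ → ℕ → ℕ → ℝ)
    (hy0 : 0 < y) (hy1 : y < 1) (hq0 : 0 < q) (hS : 0 < S) (hΔ0 : 0 < Δ) (hw0 : ∀ s, 0 ≤ w s)
    (hnolow : ∀ s, 0 < w s → Δ ≤ 2 * (s : ℝ)) (hjM : j < M) (hM : M₁ + M₂ ≤ M) (hμ0 : ∀ h, 0 ≤ μ₁ h)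
    (hf : ∀ s, 1 ≤ s → s ≤ j → s ≤ M₂ → 0 < w s → IsFlowAtT y S (j - s) M₁ (gate μ₁ q) (f s))
    (hL : ∀ t, 1 ≤ t → L t = ∑ s ∈ Finset.range (M₂ + 1), w s * (if s ≤ t then q * μ₁ (t - s) else 0)) :
    ∃ φ : ℕ → ℕ → ℝ,
      (∀ t k, 0 ≤ φ t k) ∧
      (∀ t k, 0 < φ t k → t ≤ j ∧ 2 * (t : ℝ) < S + Δ ∧ k ≤ M ∧ (j + 1 ≤ k ∨ S + Δ < (t : ℝ) + k)) ∧
      (∀ t k, ¬ ((1 ≤ t ∧ t ≤ j ∧ 2 * (t : ℝ) < S + Δ) ∧ 1 ≤ k ∧ k ≤ j) → φ t k = 0) ∧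
      (∀ k, 1 ≤ k → k ≤ j → ∑ t ∈ Finset.range (j + 1), usage y (S + Δ) j t k * φ t k ≤ L k) ∧
      (∀ t, (1 ≤ t ∧ t ≤ j ∧ 2 * (t : ℝ) < S + Δ) → ∑ k ∈ Finset.range (M + 1), φ t k ≤ L t) ∧
      ((y / (1 - y) * ((1 - q) * ∑ s ∈ (Finset.range (M₂ + 1)).filter (fun s => 1 ≤ s ∧ s ≤ j ∧ 0 < w s), w s
          + ∑ t ∈ Finset.range (j + 1),
            (if (1 ≤ t ∧ t ≤ j ∧ 2 * (t : ℝ) < S + Δ) then L t - ∑ k ∈ Finset.range (M + 1), φ t k else 0))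
          ≤ ∑ s ∈ (Finset.range (M₂ + 1)).filter (fun s => 1 ≤ s ∧ s ≤ j ∧ 0 < w s),
              w s * ∑ h ∈ Finset.Ico (j - s + 1) (M₁ + 1), gate μ₁ q h) ∨
       (∀ t, (1 ≤ t ∧ t ≤ j ∧ 2 * (t : ℝ) < S + Δ) → ∑ k ∈ Finset.range (M + 1), φ t k = L t)) := by
  classical
  set S' : ℝ := S + Δ with hS'
  set uy : ℝ := y / (1 - y) with huy
  set C : Finset ℕ := (Finset.range (M₂ + 1)).filter (fun s => 1 ≤ s ∧ s ≤ j ∧ 0 < w s) with hC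
  have h1y : 0 < 1 - y := by linarith
  have huy0 : 0 < uy := div_pos hy0 h1y
  have hνpos : ∀ h, 1 ≤ h → gate μ₁ q h = q * μ₁ h := fun h hh => by rw [gate_apply, if_neg (by omega)]; ring
  have hCmem : ∀ s, s ∈ C ↔ s ≤ M₂ ∧ 1 ≤ s ∧ s ≤ j ∧ 0 < w s := by
    intro s; rw [hC, Finset.mem_filter, Finset.mem_range]; constructor
    · rintro ⟨h1, h2⟩; exact ⟨by omega, h2⟩
    · rintro ⟨h1, h2⟩; exact ⟨by omega, h2⟩
  have hw00 : w 0 = 0 := by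
    rcases (hw0 0).eq_or_lt with hz | hp
    · exact hz.symm
    · have := hnolow 0 hp; simp at this; linarith
  /- ### the pieces of the present copies -/
  have key : ∀ s, ∃ (mid : ℕ → ℕ → ℝ) (slot : ℕ → ℝ) (R : ℕ → ℝ), s ∈ C →
      (∀ t k, 0 ≤ mid t k) ∧ (∀ k, 0 ≤ slot k) ∧ (∀ t, 0 ≤ R t) ∧
      (∀ t k, 0 < mid t k → (s + 1 ≤ t ∧ t ≤ j ∧ 2 * (t : ℝ) < S + Δ) ∧ s + 1 ≤ k ∧ k ≤ j ∧ k ≤ M₁ + s ∧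
        S + Δ < (t : ℝ) + k) ∧
      (∀ t k, ¬ ((s + 1 ≤ t ∧ t ≤ j ∧ 2 * (t : ℝ) < S + Δ) ∧ s + 1 ≤ k ∧ k ≤ j) → mid t k = 0) ∧
      (∀ k, 0 < slot k → s + 1 ≤ k ∧ k ≤ j ∧ k ≤ M₁ + s ∧ S < (((k - s : ℕ)) : ℝ)) ∧
      (∀ k, ¬ (s + 1 ≤ k ∧ k ≤ j) → slot k = 0) ∧
      (∀ k, s + 1 ≤ k → k ≤ j →
        ∑ t ∈ Finset.range (j + 1), usage y (S + Δ) j t k * mid t k + usage y S (j - s) 0 (k - s) * slot k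
          ≤ w s * ∑ l ∈ Finset.range (j - s + 1), usage y S (j - s) l (k - s) * f s l (k - s)) ∧
      (∀ k, s + 1 ≤ k → k ≤ j →
        w s * ∑ l ∈ Finset.range (j - s + 1), usage y S (j - s) l (k - s) * f s l (k - s) ≤ w s * gate μ₁ q (k - s)) ∧
      (∀ t, (s + 1 ≤ t ∧ t ≤ j ∧ 2 * (t : ℝ) < S + Δ) → ∑ k ∈ Finset.range (M + 1), mid t k + R t = w s * (q * μ₁ (t - s))) ∧
      ((2 * (s : ℝ) < S + Δ → R s = w s * (q * μ₁ 0)) ∧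
        (∀ t, ¬ (s + 1 ≤ t ∧ t ≤ j ∧ 2 * (t : ℝ) < S + Δ) → ¬ (t = s ∧ 2 * (s : ℝ) < S + Δ) → R t = 0)) ∧
      (y / (1 - y) * (w s * (1 - q) + ∑ t ∈ Finset.range (j + 1), R t - ∑ k ∈ Finset.range (M + 1), slot k)
        ≤ w s * ∑ h ∈ Finset.Ico (j - s + 1) (M₁ + 1), gate μ₁ q h) := by
    intro s
    by_cases hs : s ∈ C
    · obtain ⟨hsM₂, hs1, hsj, hws⟩ := (hCmem s).1 hs
      obtain ⟨mid, slot, R, h1, h2, h3, h4, h5, h6, h7, h8, h9, h10, h11, -, -, -, h15⟩ :=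
        lightPair_copy y S Δ q (w s) (j - s) s j M₁ M μ₁ (f s) hy0 hy1 hq0 (hw0 s) hS (hnolow s hws) hs1 (by omega) (by omega) hjM
          hμ0 (hf s hs1 hsj hsM₂ hws)
      exact ⟨mid, slot, R, fun _ => ⟨h1, h2, h3, h4, h5, h6, h7, h8, h9, h10, h11, h15⟩⟩
    · exact ⟨fun _ _ => 0, fun _ => 0, fun _ => 0, fun h => absurd h hs⟩
  choose mid slot R hP using key
  have hm0 : ∀ s ∈ C, ∀ t k, 0 ≤ mid s t k := fun s hs => (hP s hs).1
  have hsl0 : ∀ s ∈ C, ∀ k, 0 ≤ slot s k := fun s hs => (hP s hs).2.1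
  have hR0' : ∀ s ∈ C, ∀ t, 0 ≤ R s t := fun s hs => (hP s hs).2.2.1
  have hmsupp : ∀ s ∈ C, ∀ t k, 0 < mid s t k → (s + 1 ≤ t ∧ t ≤ j ∧ 2 * (t : ℝ) < S') ∧ s + 1 ≤ k ∧ k ≤ j ∧ k ≤ M₁ + s ∧
      S' < (t : ℝ) + k := fun s hs => (hP s hs).2.2.2.1
  have hmz : ∀ s ∈ C, ∀ t k, ¬ ((s + 1 ≤ t ∧ t ≤ j ∧ 2 * (t : ℝ) < S') ∧ s + 1 ≤ k ∧ k ≤ j) → mid s t k = 0 :=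
    fun s hs => (hP s hs).2.2.2.2.1
  have hssupp : ∀ s ∈ C, ∀ k, 0 < slot s k → s + 1 ≤ k ∧ k ≤ j ∧ k ≤ M₁ + s ∧ S < (((k - s : ℕ)) : ℝ) :=
    fun s hs => (hP s hs).2.2.2.2.2.1
  have hsz : ∀ s ∈ C, ∀ k, ¬ (s + 1 ≤ k ∧ k ≤ j) → slot s k = 0 := fun s hs => (hP s hs).2.2.2.2.2.2.1
  have hcol : ∀ s ∈ C, ∀ k, s + 1 ≤ k → k ≤ j →
      ∑ t ∈ Finset.range (j + 1), usage y S' j t k * mid s t k + usage y S (j - s) 0 (k - s) * slot s k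
        ≤ w s * ∑ l ∈ Finset.range (j - s + 1), usage y S (j - s) l (k - s) * f s l (k - s) := fun s hs => (hP s hs).2.2.2.2.2.2.2.1
  have hcap : ∀ s ∈ C, ∀ k, s + 1 ≤ k → k ≤ j →
      w s * ∑ l ∈ Finset.range (j - s + 1), usage y S (j - s) l (k - s) * f s l (k - s) ≤ w s * gate μ₁ q (k - s) :=
    fun s hs => (hP s hs).2.2.2.2.2.2.2.2.1
  have hrow : ∀ s ∈ C, ∀ t, (s + 1 ≤ t ∧ t ≤ j ∧ 2 * (t : ℝ) < S') →
      ∑ k ∈ Finset.range (M + 1), mid s t k + R s t = w s * (q * μ₁ (t - s)) := fun s hs => (hP s hs).2.2.2.2.2.2.2.2.2.1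
  have hRs : ∀ s ∈ C, 2 * (s : ℝ) < S' → R s s = w s * (q * μ₁ 0) := fun s hs => (hP s hs).2.2.2.2.2.2.2.2.2.2.1.1
  have hRz' : ∀ s ∈ C, ∀ t, ¬ (s + 1 ≤ t ∧ t ≤ j ∧ 2 * (t : ℝ) < S') → ¬ (t = s ∧ 2 * (s : ℝ) < S') → R s t = 0 :=
    fun s hs => (hP s hs).2.2.2.2.2.2.2.2.2.2.1.2
  have hkey : ∀ s ∈ C, uy * (w s * (1 - q) + ∑ t ∈ Finset.range (j + 1), R s t - ∑ k ∈ Finset.range (M + 1), slot s k)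
      ≤ w s * ∑ h ∈ Finset.Ico (j - s + 1) (M₁ + 1), gate μ₁ q h := fun s hs => (hP s hs).2.2.2.2.2.2.2.2.2.2.2
  /- ### pooling -/
  set slotP : ℕ → ℝ := fun k => ∑ s ∈ C, slot s k with hslotP
  set RP : ℕ → ℝ := fun t => ∑ s ∈ C, R s t with hRP
  set zmid : ℝ := ∑ k ∈ Finset.range (M + 1), slotP k with hzmid
  set Q : ℝ := ∑ t ∈ Finset.range (j + 1), RP t with hQ
  set D : ℝ := max Q zmid with hD
  set ρ : ℕ → ℝ := fun t => RP t / D with hρ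
  set φ : ℕ → ℕ → ℝ := fun t k =>
    (∑ s ∈ C, mid s t k) + (if (1 ≤ t ∧ t ≤ j ∧ 2 * (t : ℝ) < S') then ρ t * slotP k else 0) with hφ
  have hslotP0 : ∀ k, 0 ≤ slotP k := fun k => Finset.sum_nonneg fun s hs => hsl0 s hs k
  have hRP0 : ∀ t, 0 ≤ RP t := fun t => Finset.sum_nonneg fun s hs => hR0' s hs t
  have hzmid0 : 0 ≤ zmid := Finset.sum_nonneg fun k _ => hslotP0 k
  have hQ0 : 0 ≤ Q := Finset.sum_nonneg fun t _ => hRP0 t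
  have hQD : Q ≤ D := le_max_left _ _
  have hzD : zmid ≤ D := le_max_right _ _
  have hD0 : 0 ≤ D := le_trans hQ0 hQD
  have hρ0 : ∀ t, 0 ≤ ρ t := fun t => div_nonneg (hRP0 t) hD0
  have hRsz : ∀ s ∈ C, ∀ t, ¬ (1 ≤ t ∧ t ≤ j ∧ 2 * (t : ℝ) < S') → R s t = 0 := by
    intro s hs t ht
    obtain ⟨_, hs1, hsj, _⟩ := (hCmem s).1 hs
    exact hRz' s hs t (fun hc => ht ⟨by omega, hc.2.1, hc.2.2⟩) (fun hc => ht ⟨by omega, by omega, hc.1 ▸ hc.2⟩)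
  have hRPz : ∀ t, ¬ (1 ≤ t ∧ t ≤ j ∧ 2 * (t : ℝ) < S') → RP t = 0 := fun t ht =>
    Finset.sum_eq_zero fun s hs => hRsz s hs t ht
  have hRslo : ∀ s ∈ C, ∀ t, 0 < R s t → s ≤ t := by
    intro s hs t hp
    by_contra hlt
    have h1 : R s t = 0 := hRz' s hs t (fun hc => hlt (by omega)) (fun hc => hlt (by omega))
    rw [h1] at hp; exact lt_irrefl _ hp
  -- a charged `RP t` has a present copy `s ≤ t`, so `Δ ≤ 2t`
  have hRPlo : ∀ t, 0 < RP t → Δ ≤ 2 * (t : ℝ) := by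
    intro t hp
    have hp' : ∑ s ∈ C, (0 : ℝ) < ∑ s ∈ C, R s t := by rw [Finset.sum_const_zero]; simpa [hRP] using hp
    obtain ⟨s, hs, hps⟩ := Finset.exists_lt_of_sum_lt hp'
    obtain ⟨_, _, _, hws⟩ := (hCmem s).1 hs
    have hst : (s : ℝ) ≤ t := by exact_mod_cast hRslo s hs t hps
    linarith [hnolow s hws]
  have hρz : ∀ t, ¬ (1 ≤ t ∧ t ≤ j ∧ 2 * (t : ℝ) < S') → ρ t = 0 := fun t ht => by
    simp only [hρ]; rw [hRPz t ht, zero_div]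
  have hρsum : ∑ t ∈ Finset.range (j + 1), ρ t = Q / D := by simp only [hρ]; rw [← Finset.sum_div]
  have hQD1 : Q / D ≤ 1 := by
    rcases hD0.eq_or_lt with hz | hpos
    · rw [← hz, div_zero]; exact zero_le_one
    · exact (div_le_one hpos).2 hQD
  have hρsum1 : ∑ t ∈ Finset.range (j + 1), ρ t ≤ 1 := hρsum ▸ hQD1
  have hρz_le : ∀ t, ρ t * zmid ≤ RP t := by
    intro t
    simp only [hρ]
    rcases hD0.eq_or_lt with hz | hpos
    · rw [← hz, div_zero, zero_mul]; exact hRP0 t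
    · rw [div_mul_eq_mul_div, div_le_iff₀ hpos]
      exact mul_le_mul_of_nonneg_left hzD (hRP0 t)
  have hρpos_RP : ∀ t, 0 < ρ t → 0 < RP t := by
    intro t hρp
    simp only [hρ] at hρp
    rcases (hRP0 t).eq_or_lt with hz | hpos
    · rw [← hz, zero_div] at hρp; exact absurd hρp (lt_irrefl 0)
    · exact hpos
  /- ### `L` on a nonzero low splits along the present copies -/
  have hLs : ∀ s ∈ C, ∀ t, (1 ≤ t ∧ t ≤ j ∧ 2 * (t : ℝ) < S') →
      ∑ k ∈ Finset.range (M + 1), mid s t k + R s t = w s * (if s ≤ t then q * μ₁ (t - s) else 0) := by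
    intro s hs t ht
    by_cases h1 : s + 1 ≤ t
    · rw [hrow s hs t ⟨h1, ht.2.1, ht.2.2⟩, if_pos (by omega)]
    · have hm : ∑ k ∈ Finset.range (M + 1), mid s t k = 0 :=
        Finset.sum_eq_zero fun k _ => hmz s hs t k (fun hc => h1 hc.1.1)
      rw [hm, zero_add]
      by_cases h2 : t = s
      · subst h2
        rw [hRs t hs ht.2.2, if_pos le_rfl, Nat.sub_self]
      · rw [hRz' s hs t (fun hc => h1 hc.1) (fun hc => h2 hc.1), if_neg (by omega), mul_zero]
  have hLt : ∀ t, (1 ≤ t ∧ t ≤ j ∧ 2 * (t : ℝ) < S') →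
      L t = ∑ s ∈ C, (∑ k ∈ Finset.range (M + 1), mid s t k) + RP t := by
    intro t ht
    rw [hL t ht.1]
    have hsplit : ∑ s ∈ Finset.range (M₂ + 1), w s * (if s ≤ t then q * μ₁ (t - s) else 0)
        = ∑ s ∈ C, w s * (if s ≤ t then q * μ₁ (t - s) else 0) := by
      rw [hC, Finset.sum_filter]
      refine Finset.sum_congr rfl fun s hsr => ?_
      rw [Finset.mem_range] at hsr
      by_cases hc : 1 ≤ s ∧ s ≤ j ∧ 0 < w s
      · rw [if_pos hc]
      · rw [if_neg hc]
        by_cases hs0 : s = 0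
        · subst hs0; rw [hw00, zero_mul]
        by_cases hsj : s ≤ j
        · have hw : w s = 0 := by
            rcases (hw0 s).eq_or_lt with hz | hp
            · exact hz.symm
            · exact absurd ⟨by omega, hsj, hp⟩ hc
          rw [hw, zero_mul]
        · rw [if_neg (by omega), mul_zero]
    rw [hsplit, hRP, ← Finset.sum_add_distrib]
    exact Finset.sum_congr rfl fun s hs => (hLs s hs t ht).symm
  have hrowφ : ∀ t, (1 ≤ t ∧ t ≤ j ∧ 2 * (t : ℝ) < S') →
      L t - ∑ k ∈ Finset.range (M + 1), φ t k = RP t - ρ t * zmid := by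
    intro t ht
    have hsplit : ∑ k ∈ Finset.range (M + 1), φ t k
        = ∑ s ∈ C, (∑ k ∈ Finset.range (M + 1), mid s t k) + ρ t * zmid := by
      simp only [hφ]
      rw [Finset.sum_add_distrib, Finset.sum_comm]
      simp only [if_pos ht]
      rw [← Finset.mul_sum]
    rw [hsplit, hLt t ht]; ring
  /- ### the six conjuncts -/
  have hφ0 : ∀ t k, 0 ≤ φ t k := fun t k => by
    simp only [hφ]
    refine add_nonneg (Finset.sum_nonneg fun s hs => hm0 s hs t k) ?_
    split_ifs
    · exact mul_nonneg (hρ0 t) (hslotP0 k)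
    · exact le_rfl
  have hslot_term : ∀ t k, 0 < (if (1 ≤ t ∧ t ≤ j ∧ 2 * (t : ℝ) < S') then ρ t * slotP k else 0) →
      (1 ≤ t ∧ t ≤ j ∧ 2 * (t : ℝ) < S') ∧ Δ ≤ 2 * (t : ℝ) ∧ 0 < slotP k := by
    intro t k hp
    by_cases ht : (1 ≤ t ∧ t ≤ j ∧ 2 * (t : ℝ) < S')
    · rw [if_pos ht] at hp
      have hρp : 0 < ρ t := by
        rcases (hρ0 t).eq_or_lt with hz | hpos
        · rw [← hz, zero_mul] at hp; exact absurd hp (lt_irrefl 0)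
        · exact hpos
      have hsl : 0 < slotP k := by
        rcases (hslotP0 k).eq_or_lt with hz | hpos
        · rw [← hz, mul_zero] at hp; exact absurd hp (lt_irrefl 0)
        · exact hpos
      exact ⟨ht, hRPlo t (hρpos_RP t hρp), hsl⟩
    · rw [if_neg ht] at hp; exact absurd hp (lt_irrefl 0)
  -- a charged pooled slot has a charged copy slot
  have hslotP_pos : ∀ k, 0 < slotP k → ∃ s ∈ C, 0 < slot s k := fun k hp => by
    have hp' : ∑ s ∈ C, (0 : ℝ) < ∑ s ∈ C, slot s k := by rw [Finset.sum_const_zero]; simpa [hslotP] using hp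
    exact Finset.exists_lt_of_sum_lt hp'
  have hφsupp : ∀ t k, 0 < φ t k → t ≤ j ∧ 2 * (t : ℝ) < S' ∧ k ≤ M ∧ (j + 1 ≤ k ∨ S' < (t : ℝ) + k) := by
    intro t k hp
    simp only [hφ] at hp
    by_cases hA : 0 < ∑ s ∈ C, mid s t k
    · have hA' : ∑ s ∈ C, (0 : ℝ) < ∑ s ∈ C, mid s t k := by rwa [Finset.sum_const_zero]
      obtain ⟨s, hs, hps⟩ := Finset.exists_lt_of_sum_lt hA'
      obtain ⟨ht, _, hkj, _, hc⟩ := hmsupp s hs t k hps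
      exact ⟨ht.2.1, ht.2.2, by omega, Or.inr hc⟩
    · have hA0 : ∑ s ∈ C, mid s t k = 0 := le_antisymm (not_lt.1 hA) (Finset.sum_nonneg fun s hs => hm0 s hs t k)
      rw [hA0, zero_add] at hp
      obtain ⟨ht, hΔt, hsl⟩ := hslot_term t k hp
      obtain ⟨s, hs, hps⟩ := hslotP_pos k hsl
      obtain ⟨hk1, hkj, _, hSk⟩ := hssupp s hs k hps
      obtain ⟨_, _, _, hws⟩ := (hCmem s).1 hs
      have hΔs := hnolow s hws
      refine ⟨ht.2.1, ht.2.2, by omega, Or.inr ?_⟩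
      have ek : (((k - s : ℕ)) : ℝ) = (k : ℝ) - s := by push_cast [Nat.cast_sub (show s ≤ k by omega)]; ring
      rw [ek] at hSk; rw [hS']; linarith
  have hφz : ∀ t k, ¬ ((1 ≤ t ∧ t ≤ j ∧ 2 * (t : ℝ) < S') ∧ 1 ≤ k ∧ k ≤ j) → φ t k = 0 := by
    intro t k hn
    by_contra hne
    have hp : 0 < φ t k := lt_of_le_of_ne (hφ0 t k) (Ne.symm hne)
    simp only [hφ] at hp
    by_cases hA : 0 < ∑ s ∈ C, mid s t k
    · have hA' : ∑ s ∈ C, (0 : ℝ) < ∑ s ∈ C, mid s t k := by rwa [Finset.sum_const_zero]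
      obtain ⟨s, hs, hps⟩ := Finset.exists_lt_of_sum_lt hA'
      obtain ⟨ht, hk1, hkj, _, _⟩ := hmsupp s hs t k hps
      exact hn ⟨⟨by omega, ht.2.1, ht.2.2⟩, by omega, hkj⟩
    · have hA0 : ∑ s ∈ C, mid s t k = 0 := le_antisymm (not_lt.1 hA) (Finset.sum_nonneg fun s hs => hm0 s hs t k)
      rw [hA0, zero_add] at hp
      obtain ⟨ht, _, hsl⟩ := hslot_term t k hp
      obtain ⟨s, hs, hps⟩ := hslotP_pos k hsl
      obtain ⟨hk1, hkj, _, _⟩ := hssupp s hs k hps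
      exact hn ⟨ht, by omega, hkj⟩
  have hcolφ : ∀ k, 1 ≤ k → k ≤ j → ∑ t ∈ Finset.range (j + 1), usage y S' j t k * φ t k ≤ L k := by
    intro k hk1 hkj
    -- per present copy: slot part at the zero's price, mid part, together `≤ w_s [s ≤ k] q μ₁(k−s)`
    have hslot_s : ∀ s ∈ C, ∑ t ∈ Finset.range (j + 1), usage y S' j t k *
        (if (1 ≤ t ∧ t ≤ j ∧ 2 * (t : ℝ) < S') then ρ t * slot s k else 0) ≤ usage y S (j - s) 0 (k - s) * slot s k := by
      intro s hs
      obtain ⟨_, _, _, hws⟩ := (hCmem s).1 hs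
      have hΔs := hnolow s hws
      rcases (hsl0 s hs k).eq_or_lt with hz | hsp
      · have : ∀ t ∈ Finset.range (j + 1), usage y S' j t k *
            (if (1 ≤ t ∧ t ≤ j ∧ 2 * (t : ℝ) < S') then ρ t * slot s k else 0) = 0 := by
          intro t _; rw [← hz]; split_ifs <;> simp
        rw [Finset.sum_eq_zero this, ← hz, mul_zero]
      · obtain ⟨hk1', hkj', _, hSk⟩ := hssupp s hs k hsp
        refine slot_term_le y S' _ _ j k ρ _ hρ0 hρsum1 hsp.le
          (usage_zero_mid_nonneg y S (j - s) (k - s) hy0 hy1 hS hSk (by omega)) (fun t ht hρp => ?_)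
        have hΔt : Δ ≤ 2 * (t : ℝ) := hRPlo t (hρpos_RP t hρp)
        have e1 : j = (j - s) + s := by omega
        have e2 : k = (k - s) + s := by omega
        rw [hS', e1, e2]
        simp only [Nat.add_sub_cancel]
        exact usage_slot_le_shift y S Δ (j - s) s t (k - s) hy0 hy1 hS hSk (by omega) hΔt hΔs (by rw [← hS']; exact ht.2.2)
    have hcopy : ∀ s ∈ C, ∑ t ∈ Finset.range (j + 1), usage y S' j t k * mid s t k + usage y S (j - s) 0 (k - s) * slot s k
        ≤ w s * (if s ≤ k then q * μ₁ (k - s) else 0) := by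
      intro s hs
      by_cases hk : s + 1 ≤ k
      · refine le_trans (hcol s hs k hk hkj) (le_trans (hcap s hs k hk hkj) ?_)
        rw [if_pos (by omega), hνpos (k - s) (by omega)]
      · have h1 : ∑ t ∈ Finset.range (j + 1), usage y S' j t k * mid s t k = 0 :=
          Finset.sum_eq_zero fun t _ => by rw [hmz s hs t k (fun hc => hk hc.2.1), mul_zero]
        rw [h1, hsz s hs k (fun hc => hk hc.1), mul_zero, zero_add]
        split_ifs
        · exact mul_nonneg (hw0 s) (mul_nonneg hq0.le (hμ0 _))
        · simp
    have hsplit : ∑ t ∈ Finset.range (j + 1), usage y S' j t k * φ t k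
        = ∑ s ∈ C, (∑ t ∈ Finset.range (j + 1), usage y S' j t k * mid s t k
            + ∑ t ∈ Finset.range (j + 1), usage y S' j t k *
                (if (1 ≤ t ∧ t ≤ j ∧ 2 * (t : ℝ) < S') then ρ t * slot s k else 0)) := by
      have e : ∀ s ∈ C, (∑ t ∈ Finset.range (j + 1), usage y S' j t k * mid s t k
            + ∑ t ∈ Finset.range (j + 1), usage y S' j t k *
                (if (1 ≤ t ∧ t ≤ j ∧ 2 * (t : ℝ) < S') then ρ t * slot s k else 0))
          = ∑ t ∈ Finset.range (j + 1), (usage y S' j t k * mid s t k + usage y S' j t k *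
                (if (1 ≤ t ∧ t ≤ j ∧ 2 * (t : ℝ) < S') then ρ t * slot s k else 0)) :=
        fun s _ => Finset.sum_add_distrib.symm
      rw [Finset.sum_congr rfl e, Finset.sum_comm]
      refine Finset.sum_congr rfl fun t _ => ?_
      simp only [hφ, hslotP]
      by_cases ht : (1 ≤ t ∧ t ≤ j ∧ 2 * (t : ℝ) < S')
      · simp only [if_pos ht]
        rw [mul_add, Finset.mul_sum, Finset.mul_sum, Finset.mul_sum, ← Finset.sum_add_distrib]
      · simp only [if_neg ht, mul_zero, add_zero]
        rw [Finset.mul_sum]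
    -- `L k ≥ Σ_{s ∈ C} w_s [s ≤ k] q μ₁(k−s)` (the other terms of `L k` are nonnegative)
    have hLk : ∑ s ∈ C, w s * (if s ≤ k then q * μ₁ (k - s) else 0) ≤ L k := by
      rw [hL k hk1, hC, Finset.sum_filter]
      refine Finset.sum_le_sum fun s _ => ?_
      split_ifs <;> first | exact le_rfl | exact mul_nonneg (hw0 s) (mul_nonneg hq0.le (hμ0 _)) | simp
    rw [hsplit]
    refine le_trans (Finset.sum_le_sum fun s hs => ?_) hLk
    linarith [hslot_s s hs, hcopy s hs]
  have hrows : ∀ t, (1 ≤ t ∧ t ≤ j ∧ 2 * (t : ℝ) < S') → ∑ k ∈ Finset.range (M + 1), φ t k ≤ L t := by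
    intro t ht
    linarith [hrowφ t ht, hρz_le t]
  refine ⟨φ, hφ0, hφsupp, hφz, hcolφ, hrows, ?_⟩
  by_cases hcase : zmid ≤ Q
  · left
    have hlhs : ∑ t ∈ Finset.range (j + 1),
        (if (1 ≤ t ∧ t ≤ j ∧ 2 * (t : ℝ) < S') then L t - ∑ k ∈ Finset.range (M + 1), φ t k else 0) = Q - zmid := by
      have e : ∀ t ∈ Finset.range (j + 1),
          (if (1 ≤ t ∧ t ≤ j ∧ 2 * (t : ℝ) < S') then L t - ∑ k ∈ Finset.range (M + 1), φ t k else 0)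
            = RP t - ρ t * zmid := by
        intro t _
        by_cases ht : (1 ≤ t ∧ t ≤ j ∧ 2 * (t : ℝ) < S')
        · rw [if_pos ht, hrowφ t ht]
        · rw [if_neg ht, hRPz t ht, hρz t ht]; ring
      rw [Finset.sum_congr rfl e, Finset.sum_sub_distrib, ← Finset.sum_mul, ← hQ, hρsum]
      have hk : Q / D * zmid = zmid := by
        have hDQ : D = Q := max_eq_left hcase
        rcases hQ0.eq_or_lt with hz | hpos
        · have hz0 : zmid = 0 := le_antisymm (by rw [hz]; exact hcase) hzmid0
          rw [hz0, mul_zero]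
        · rw [hDQ, div_self (ne_of_gt hpos), one_mul]
      rw [hk]
    rw [hlhs]
    have hQsplit : Q = ∑ s ∈ C, ∑ t ∈ Finset.range (j + 1), R s t := by rw [hQ]; simp only [hRP]; rw [Finset.sum_comm]
    have hzsplit : zmid = ∑ s ∈ C, ∑ k ∈ Finset.range (M + 1), slot s k := by
      rw [hzmid]; simp only [hslotP]; rw [Finset.sum_comm]
    have e : uy * ((1 - q) * ∑ s ∈ C, w s + (Q - zmid))
        = ∑ s ∈ C, uy * (w s * (1 - q) + ∑ t ∈ Finset.range (j + 1), R s t - ∑ k ∈ Finset.range (M + 1), slot s k) := by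
      rw [hQsplit, hzsplit, ← Finset.mul_sum]
      congr 1
      rw [Finset.mul_sum, ← Finset.sum_sub_distrib, ← Finset.sum_add_distrib]
      exact Finset.sum_congr rfl fun s _ => by ring
    rw [e]
    exact Finset.sum_le_sum fun s hs => hkey s hs
  · right
    have hQlt : Q < zmid := not_le.1 hcase
    have hzpos : 0 < zmid := lt_of_le_of_lt hQ0 hQlt
    have hDz : D = zmid := max_eq_right hQlt.le
    intro t ht
    have h := hrowφ t ht
    have hρa : ρ t * zmid = RP t := by
      simp only [hρ]; rw [hDz, div_mul_cancel₀ _ (ne_of_gt hzpos)]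
    linarith

end LawDec

end Quant

end Summit.CriticalPhenomena.PercolationContinuityZ3.Theorems
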